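import Mathlib
import HarnessLib
import Literature.MathematicalPhysics.QuantumFieldTheory.LatticeGaugeStaticPotentialProofs
import Summits.QuantumFields.YangMills.Theorems.FemtoCurvatureSkewness.Negative.ZeroCoupling

/-!
# `FemtoCurvatureSkewness` — stub `HypercubicCovSymmetry` of line `Sketch-ideator3` (crux stmt-QuantumFields-9365)

The torus Wilson state is invariant under the coordinate permutation `2 ↔ 3`
(`wilsonExpectation_comp_configPerm`, `plaquetteHolonomy_configPerm` of
`Literature/MathematicalPhysics/QuantumFieldTheory/LatticeGaugeStaticPotentialProofs.lean`), which fixes the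
`(0,1)`-plane and maps the arm site `n e₃` to `n e₂`; hence the axis covariances of the crux's plaquette field agree:
`Cov(P_0^{01}, P_{ne₃}^{01}) = Cov(P_0^{01}, P_{ne₂}^{01})`.
-/

noncomputable section

namespace Summit.QuantumFields.YangMills.Theorems.FemtoCurvatureSkewness

open MeasureTheory
open Literature.MathematicalPhysics.QuantumFieldTheory
open Summit.QuantumFields.YangMills.Theorems.FemtoCurvatureSkewness.Negative (plaq wE wCov)

/-- **Hypercubic symmetry of the axis covariances** (stub `HypercubicCovSymmetry`, registered signature verbatim):
`Cov_{L,β}(P_0^{01}, P_{ne₃}^{01}) = Cov_{L,β}(P_0^{01}, P_{ne₂}^{01})` on every torus, every coupling, every compact `G`. -/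
theorem HypercubicCovSymmetry :
  ∀ (G : Type) [Group G] [TopologicalSpace G] [IsTopologicalGroup G] [CompactSpace G]
    [MeasurableSpace G] [BorelSpace G] (r : LatticeRep G) (L : ℕ) [NeZero L] (β : ℝ) (n : ℕ),
    wCov r L β (plaq r L 0 0 1) (plaq r L (Pi.single (3 : Fin 4) ((n : ℕ) : ZMod L)) 0 1) =
      wCov r L β (plaq r L 0 0 1) (plaq r L (Pi.single (2 : Fin 4) ((n : ℕ) : ZMod L)) 0 1) := by
  intro G _ _ _ _ _ _ r L _ β n
  -- the axis swap `2 ↔ 3` fixes the `(0,1)`-plane and the origin, and maps the arm site `n e₃` to `n e₂`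
  have hsymm : (Equiv.swap (2 : Fin 4) 3).symm = Equiv.swap (2 : Fin 4) 3 := Equiv.symm_swap 2 3
  have h0 : Equiv.swap (2 : Fin 4) 3 0 = 0 := Equiv.swap_apply_of_ne_of_ne (by decide) (by decide)
  have h1 : Equiv.swap (2 : Fin 4) 3 1 = 1 := Equiv.swap_apply_of_ne_of_ne (by decide) (by decide)
  have hs0 : sitePerm (Equiv.swap (2 : Fin 4) 3) (0 : Site 4 L) = 0 := by
    funext j
    simp only [sitePerm_apply, Pi.zero_apply]
  have hs3 : sitePerm (Equiv.swap (2 : Fin 4) 3) (Pi.single (3 : Fin 4) ((n : ℕ) : ZMod L) : Site 4 L) =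
      Pi.single (2 : Fin 4) ((n : ℕ) : ZMod L) := by
    rw [sitePerm_single, Equiv.swap_apply_right]
  have hp0 : ∀ U : GaugeConfig 4 L G,
      plaq r L 0 0 1 (configPerm (Equiv.swap (2 : Fin 4) 3) U) = plaq r L 0 0 1 U := fun U => by
    simp only [plaq, plaquetteHolonomy_configPerm, hsymm, h0, h1, hs0]
  have hp3 : ∀ U : GaugeConfig 4 L G,
      plaq r L (Pi.single (3 : Fin 4) ((n : ℕ) : ZMod L)) 0 1 (configPerm (Equiv.swap (2 : Fin 4) 3) U) =
        plaq r L (Pi.single (2 : Fin 4) ((n : ℕ) : ZMod L)) 0 1 U := fun U => by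
    simp only [plaq, plaquetteHolonomy_configPerm, hsymm, h0, h1, hs3]
  -- invariance of the torus Wilson state under the swap
  have key : ∀ F : GaugeConfig 4 L G → ℝ,
      wE r L β (F ∘ configPerm (Equiv.swap (2 : Fin 4) 3)) = wE r L β F := fun F =>
    wilsonExpectation_comp_configPerm r.ρ r.continuous β _ F
  have e2 : wE r L β (fun U => plaq r L 0 0 1 U * plaq r L (Pi.single (3 : Fin 4) ((n : ℕ) : ZMod L)) 0 1 U) =
      wE r L β (fun U => plaq r L 0 0 1 U * plaq r L (Pi.single (2 : Fin 4) ((n : ℕ) : ZMod L)) 0 1 U) := by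
    refine (key _).symm.trans ?_
    congr 1
    funext U
    simp only [Function.comp_apply, hp0, hp3]
  have e1 : wE r L β (plaq r L (Pi.single (3 : Fin 4) ((n : ℕ) : ZMod L)) 0 1) =
      wE r L β (plaq r L (Pi.single (2 : Fin 4) ((n : ℕ) : ZMod L)) 0 1) := by
    refine (key _).symm.trans ?_
    congr 1
    funext U
    simp only [Function.comp_apply, hp3]
  simp only [wCov, e1, e2]

end Summit.QuantumFields.YangMills.Theorems.FemtoCurvatureSkewness

end
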